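import Mathlib
import Summits.Ventures.PercRepro2.Defs
import Summits.Ventures.PercRepro2.Harris
import Summits.Ventures.PercRepro2.Graph
import Summits.Ventures.PercRepro2.Events
import Summits.Ventures.PercRepro2.KTwoFiveNegative

/-!
# The three-event inequality (T_h) is false: an exact rational witness on a 7-vertex graph
(blind cell PercRepro2, mine-a g48)

The lane's three-event inequality `(T_h)` — root `r`, hit vertex `h`, up-sets `𝓤 𝓥` of vertex
sets, `Q = {h ∈ C_r}`, `U = {C_r ∈ 𝓤}`, `e = {C_r ∈ 𝓥}`,
`P(Q ∩ U) P(e) + P(Q ∩ e) P(U) ≤ P(Q ∩ U ∩ e) + P(Q) P(U ∩ e)` — FAILS on the graph `G` with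
vertices `r = 0, h = 1, x₂, …, x₆`, edges `r–x₂, r–x₃, r–x₄, r–x₅, r–x₆, h–x₂, h–x₃, x₂–x₄, x₃–x₅,
x₄–x₆` (edges `0, …, 9`), the single-vertex up-sets `𝓤 = {x₅ ∈ T}`, `𝓥 = {x₆ ∈ T}` (the
three-point form) and the weights `24/29, 32/35, 15/17, 15/16, 44/49, 1/31, 1/31, 1/9, 1/31, 3/29`:
the form equals `−152322110525 / 512223476205017418324504 < 0` (`t_form_eq`, `t_form_neg`,
`not_t_general`; MINE-A.md §103.1 ADDENDUM 3).  Route: the root cluster in Boolean reachability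
formulas (`cluster_eq`, closure lemma + explicit open paths), every probability an integer sum over
the `2^10` configurations over `B = Π den_e = 105185679091920` (`prob_eq`), the seven integer sums
by `decide` over ten nested Boolean sums (`KTwoFive.sum_pi_succ`), numerator `−3290157587340000`.
No instance, no notation.
-/

namespace Summit.Ventures.PercRepro2

namespace THRefutation

open Finset

/-- The edge map of `G`: edges `r–x₂, r–x₃, r–x₄, r–x₅, r–x₆, h–x₂, h–x₃, x₂–x₄, x₃–x₅, x₄–x₆`. -/
def ends : Fin 10 → Sym2 (Fin 7) :=
  ![s(0, 2), s(0, 3), s(0, 4), s(0, 5), s(0, 6), s(1, 2), s(1, 3), s(2, 4), s(3, 5), s(4, 6)]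

section Reach

/-- Reachability of `x₂` from the root avoiding `h` (`l2`, `l4 ∧ a`, `l6 ∧ d ∧ a`). -/
def r2 (l2 l4 l6 a d : Bool) : Bool := l2 || (l4 && a) || (l6 && d && a)

/-- Reachability of `x₄` from the root avoiding `h`. -/
def r4 (l2 l4 l6 a d : Bool) : Bool := l4 || (l2 && a) || (l6 && d)

/-- Reachability of `x₆` from the root avoiding `h`. -/
def r6 (l2 l4 l6 a d : Bool) : Bool := l6 || (l4 && d) || (l2 && a && d)

/-- Reachability of `x₃` from the root avoiding `h`. -/
def r3 (l3 l5 b : Bool) : Bool := l3 || (l5 && b)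

/-- Reachability of `x₅` from the root avoiding `h`. -/
def r5 (l3 l5 b : Bool) : Bool := l5 || (l3 && b)

/-- Reachability of the hit vertex. -/
def hc (l2 l3 l4 l5 l6 h2 h3 a b d : Bool) : Bool :=
  (r2 l2 l4 l6 a d && h2) || (r3 l3 l5 b && h3)

/-- The Boolean membership of every vertex in the cluster of the root, as a function of the ten
edge states `l2 l3 l4 l5 l6 h2 h3 a b d`. -/
def inCf (l2 l3 l4 l5 l6 h2 h3 a b d : Bool) : Fin 7 → Bool :=
  ![true, hc l2 l3 l4 l5 l6 h2 h3 a b d,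
    r2 l2 l4 l6 a d || (hc l2 l3 l4 l5 l6 h2 h3 a b d && h2),
    r3 l3 l5 b || (hc l2 l3 l4 l5 l6 h2 h3 a b d && h3),
    r4 l2 l4 l6 a d || (hc l2 l3 l4 l5 l6 h2 h3 a b d && h2 && a),
    r5 l3 l5 b || (hc l2 l3 l4 l5 l6 h2 h3 a b d && h3 && b),
    r6 l2 l4 l6 a d || (hc l2 l3 l4 l5 l6 h2 h3 a b d && h2 && a && d)]

/-- Membership in the cluster of the root at a configuration. -/
def inC (ω : Config (Fin 10)) (v : Fin 7) : Bool :=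
  inCf (ω 0) (ω 1) (ω 2) (ω 3) (ω 4) (ω 5) (ω 6) (ω 7) (ω 8) (ω 9) v

/-- The explicit cluster set. -/
def clusterSet (ω : Config (Fin 10)) : Set (Fin 7) := {v | inC ω v = true}

/-- **Closure of the explicit set along every edge, in both directions** (a Boolean tautology in
the ten edge variables, checked by `decide`). -/
lemma closed_tauto : ∀ l2 l3 l4 l5 l6 h2 h3 a b d : Bool,
    let f := inCf l2 l3 l4 l5 l6 h2 h3 a b d
    (l2 = true → f 2 = true) ∧ (l3 = true → f 3 = true) ∧ (l4 = true → f 4 = true) ∧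
    (l5 = true → f 5 = true) ∧ (l6 = true → f 6 = true) ∧
    (h2 = true → f 1 = true → f 2 = true) ∧ (h2 = true → f 2 = true → f 1 = true) ∧
    (h3 = true → f 1 = true → f 3 = true) ∧ (h3 = true → f 3 = true → f 1 = true) ∧
    (a = true → f 2 = true → f 4 = true) ∧ (a = true → f 4 = true → f 2 = true) ∧
    (b = true → f 3 = true → f 5 = true) ∧ (b = true → f 5 = true → f 3 = true) ∧
    (d = true → f 4 = true → f 6 = true) ∧ (d = true → f 6 = true → f 4 = true) := by
  decide

/-- The explicit set is closed under open adjacency. -/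
lemma clusterSet_closed (ω : Config (Fin 10)) :
    ∀ x ∈ clusterSet ω, ∀ y, (openGraph ends ω).Adj x y → y ∈ clusterSet ω := by
  intro x hx y hxy
  obtain ⟨-, e, he, hends⟩ := openGraph_adj.1 hxy
  have ht := closed_tauto (ω 0) (ω 1) (ω 2) (ω 3) (ω 4) (ω 5) (ω 6) (ω 7) (ω 8) (ω 9)
  simp only [clusterSet, Set.mem_setOf_eq, inC] at hx ⊢
  fin_cases e <;> simp only [ends, Fin.isValue] at hends he <;>
    rcases Sym2.eq_iff.1 hends with ⟨rfl, rfl⟩ | ⟨rfl, rfl⟩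
  all_goals first
    | exact (ht.1 he) | exact (ht.2.1 he) | exact (ht.2.2.1 he) | exact (ht.2.2.2.1 he)
    | exact (ht.2.2.2.2.1 he) | exact (ht.2.2.2.2.2.1 he hx) | exact (ht.2.2.2.2.2.2.1 he hx)
    | exact (ht.2.2.2.2.2.2.2.1 he hx) | exact (ht.2.2.2.2.2.2.2.2.1 he hx)
    | exact (ht.2.2.2.2.2.2.2.2.2.1 he hx) | exact (ht.2.2.2.2.2.2.2.2.2.2.1 he hx)
    | exact (ht.2.2.2.2.2.2.2.2.2.2.2.1 he hx) | exact (ht.2.2.2.2.2.2.2.2.2.2.2.2.1 he hx)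
    | exact (ht.2.2.2.2.2.2.2.2.2.2.2.2.2.1 he hx) | exact (ht.2.2.2.2.2.2.2.2.2.2.2.2.2.2 he hx)
    | rfl

/-- Connections along single open edges (the ten edges, both ends). -/
lemma conn_edge (ω : Config (Fin 10)) (i : Fin 10) (u v : Fin 7) (h : ω i = true)
    (hi : ends i = s(u, v)) : Conn ends ω u v := conn_of_openAdj ⟨i, h, hi⟩

/-- `r2` gives a connection `r ↔ x₂` (without `h`). -/
lemma conn_of_r2 (ω : Config (Fin 10)) (h : r2 (ω 0) (ω 2) (ω 4) (ω 7) (ω 9) = true) :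
    Conn ends ω 0 2 := by
  unfold r2 at h
  simp only [Bool.or_eq_true, Bool.and_eq_true] at h
  rcases h with (h0 | ⟨h2, h7⟩) | ⟨⟨h4, h9⟩, h7⟩
  · exact conn_edge ω 0 0 2 h0 rfl
  · exact conn_trans (conn_edge ω 2 0 4 h2 rfl) (conn_symm (conn_edge ω 7 2 4 h7 rfl))
  · exact conn_trans (conn_trans (conn_edge ω 4 0 6 h4 rfl) (conn_symm (conn_edge ω 9 4 6 h9 rfl)))
      (conn_symm (conn_edge ω 7 2 4 h7 rfl))

/-- `r4` gives a connection `r ↔ x₄`. -/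
lemma conn_of_r4 (ω : Config (Fin 10)) (h : r4 (ω 0) (ω 2) (ω 4) (ω 7) (ω 9) = true) :
    Conn ends ω 0 4 := by
  unfold r4 at h
  simp only [Bool.or_eq_true, Bool.and_eq_true] at h
  rcases h with (h2 | ⟨h0, h7⟩) | ⟨h4, h9⟩
  · exact conn_edge ω 2 0 4 h2 rfl
  · exact conn_trans (conn_edge ω 0 0 2 h0 rfl) (conn_edge ω 7 2 4 h7 rfl)
  · exact conn_trans (conn_edge ω 4 0 6 h4 rfl) (conn_symm (conn_edge ω 9 4 6 h9 rfl))

/-- `r6` gives a connection `r ↔ x₆`. -/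
lemma conn_of_r6 (ω : Config (Fin 10)) (h : r6 (ω 0) (ω 2) (ω 4) (ω 7) (ω 9) = true) :
    Conn ends ω 0 6 := by
  unfold r6 at h
  simp only [Bool.or_eq_true, Bool.and_eq_true] at h
  rcases h with (h4 | ⟨h2, h9⟩) | ⟨⟨h0, h7⟩, h9⟩
  · exact conn_edge ω 4 0 6 h4 rfl
  · exact conn_trans (conn_edge ω 2 0 4 h2 rfl) (conn_edge ω 9 4 6 h9 rfl)
  · exact conn_trans (conn_trans (conn_edge ω 0 0 2 h0 rfl) (conn_edge ω 7 2 4 h7 rfl))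
      (conn_edge ω 9 4 6 h9 rfl)

/-- `r3` gives a connection `r ↔ x₃`. -/
lemma conn_of_r3 (ω : Config (Fin 10)) (h : r3 (ω 1) (ω 3) (ω 8) = true) : Conn ends ω 0 3 := by
  unfold r3 at h
  simp only [Bool.or_eq_true, Bool.and_eq_true] at h
  rcases h with h1 | ⟨h3, h8⟩
  · exact conn_edge ω 1 0 3 h1 rfl
  · exact conn_trans (conn_edge ω 3 0 5 h3 rfl) (conn_symm (conn_edge ω 8 3 5 h8 rfl))

/-- `r5` gives a connection `r ↔ x₅`. -/
lemma conn_of_r5 (ω : Config (Fin 10)) (h : r5 (ω 1) (ω 3) (ω 8) = true) : Conn ends ω 0 5 := by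
  unfold r5 at h
  simp only [Bool.or_eq_true, Bool.and_eq_true] at h
  rcases h with h3 | ⟨h1, h8⟩
  · exact conn_edge ω 3 0 5 h3 rfl
  · exact conn_trans (conn_edge ω 1 0 3 h1 rfl) (conn_edge ω 8 3 5 h8 rfl)

/-- `hc` gives a connection `r ↔ h`. -/
lemma conn_of_hc (ω : Config (Fin 10))
    (h : hc (ω 0) (ω 1) (ω 2) (ω 3) (ω 4) (ω 5) (ω 6) (ω 7) (ω 8) (ω 9) = true) :
    Conn ends ω 0 1 := by
  unfold hc at h
  simp only [Bool.or_eq_true, Bool.and_eq_true] at h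
  rcases h with ⟨hr, h5⟩ | ⟨hr, h6⟩
  · exact conn_trans (conn_of_r2 ω hr) (conn_symm (conn_edge ω 5 1 2 h5 rfl))
  · exact conn_trans (conn_of_r3 ω hr) (conn_symm (conn_edge ω 6 1 3 h6 rfl))

/-- Every vertex of the explicit set is connected to the root. -/
lemma conn_of_inC (ω : Config (Fin 10)) (v : Fin 7) (h : inC ω v = true) : Conn ends ω 0 v := by
  fin_cases v
  · exact conn_refl ends ω 0
  · exact conn_of_hc ω h
  · change (r2 (ω 0) (ω 2) (ω 4) (ω 7) (ω 9)
      || (hc (ω 0) (ω 1) (ω 2) (ω 3) (ω 4) (ω 5) (ω 6) (ω 7) (ω 8) (ω 9) && ω 5)) = true at h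
    simp only [Bool.or_eq_true, Bool.and_eq_true] at h
    rcases h with hr | ⟨hh, h5⟩
    · exact conn_of_r2 ω hr
    · exact conn_trans (conn_of_hc ω hh) (conn_edge ω 5 1 2 h5 rfl)
  · change (r3 (ω 1) (ω 3) (ω 8)
      || (hc (ω 0) (ω 1) (ω 2) (ω 3) (ω 4) (ω 5) (ω 6) (ω 7) (ω 8) (ω 9) && ω 6)) = true at h
    simp only [Bool.or_eq_true, Bool.and_eq_true] at h
    rcases h with hr | ⟨hh, h6⟩
    · exact conn_of_r3 ω hr
    · exact conn_trans (conn_of_hc ω hh) (conn_edge ω 6 1 3 h6 rfl)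
  · change (r4 (ω 0) (ω 2) (ω 4) (ω 7) (ω 9)
      || (hc (ω 0) (ω 1) (ω 2) (ω 3) (ω 4) (ω 5) (ω 6) (ω 7) (ω 8) (ω 9) && ω 5 && ω 7)) = true at h
    simp only [Bool.or_eq_true, Bool.and_eq_true] at h
    rcases h with hr | ⟨⟨hh, h5⟩, h7⟩
    · exact conn_of_r4 ω hr
    · exact conn_trans (conn_trans (conn_of_hc ω hh) (conn_edge ω 5 1 2 h5 rfl))
        (conn_edge ω 7 2 4 h7 rfl)
  · change (r5 (ω 1) (ω 3) (ω 8)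
      || (hc (ω 0) (ω 1) (ω 2) (ω 3) (ω 4) (ω 5) (ω 6) (ω 7) (ω 8) (ω 9) && ω 6 && ω 8)) = true at h
    simp only [Bool.or_eq_true, Bool.and_eq_true] at h
    rcases h with hr | ⟨⟨hh, h6⟩, h8⟩
    · exact conn_of_r5 ω hr
    · exact conn_trans (conn_trans (conn_of_hc ω hh) (conn_edge ω 6 1 3 h6 rfl))
        (conn_edge ω 8 3 5 h8 rfl)
  · change (r6 (ω 0) (ω 2) (ω 4) (ω 7) (ω 9)
      || (hc (ω 0) (ω 1) (ω 2) (ω 3) (ω 4) (ω 5) (ω 6) (ω 7) (ω 8) (ω 9) && ω 5 && ω 7 && ω 9)) = true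
      at h
    simp only [Bool.or_eq_true, Bool.and_eq_true] at h
    rcases h with hr | ⟨⟨⟨hh, h5⟩, h7⟩, h9⟩
    · exact conn_of_r6 ω hr
    · exact conn_trans (conn_trans (conn_trans (conn_of_hc ω hh) (conn_edge ω 5 1 2 h5 rfl))
        (conn_edge ω 7 2 4 h7 rfl)) (conn_edge ω 9 4 6 h9 rfl)

/-- **The cluster of the root of `G`** is the explicit set. -/
theorem cluster_eq (ω : Config (Fin 10)) : cluster ends ω 0 = clusterSet ω := by
  apply Set.Subset.antisymm
  · intro v hv
    exact mem_of_conn_of_closed (clusterSet_closed ω) (by simp [clusterSet, inC, inCf]) hv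
  · intro v hv
    exact conn_of_inC ω v hv

/-- Membership of a vertex in the cluster, decided by `inC`. -/
lemma mem_cluster_iff (ω : Config (Fin 10)) (v : Fin 7) :
    v ∈ cluster ends ω 0 ↔ inC ω v = true := by
  rw [cluster_eq]; rfl

end Reach

section Form

/-- The hit event `Q = {h ∈ C_r}` is decided by `inC · 1`. -/
lemma mem_Q_iff (ω : Config (Fin 10)) :
    ω ∈ clusterInEvent ends 0 {T : Set (Fin 7) | (1 : Fin 7) ∈ T} ↔ inC ω 1 = true := by
  rw [mem_clusterInEvent, Set.mem_setOf_eq, mem_cluster_iff]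

/-- The event `U = {x₅ ∈ C_r}` is decided by `inC · 5`. -/
lemma mem_U_iff (ω : Config (Fin 10)) :
    ω ∈ clusterInEvent ends 0 {T : Set (Fin 7) | (5 : Fin 7) ∈ T} ↔ inC ω 5 = true := by
  rw [mem_clusterInEvent, Set.mem_setOf_eq, mem_cluster_iff]

/-- The event `e = {x₆ ∈ C_r}` is decided by `inC · 6`. -/
lemma mem_e_iff (ω : Config (Fin 10)) :
    ω ∈ clusterInEvent ends 0 {T : Set (Fin 7) | (6 : Fin 7) ∈ T} ↔ inC ω 6 = true := by
  rw [mem_clusterInEvent, Set.mem_setOf_eq, mem_cluster_iff]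

/-- The numerators of the weights. -/
def num : Fin 10 → ℕ := ![24, 32, 15, 15, 44, 1, 1, 1, 1, 3]

/-- The denominators of the weights. -/
def den : Fin 10 → ℕ := ![29, 35, 17, 16, 49, 31, 31, 9, 31, 29]

/-- The rational weights `24/29, 32/35, 15/17, 15/16, 44/49, 1/31, 1/31, 1/9, 1/31, 3/29`. -/
def p : Fin 10 → ℚ := fun e => (num e : ℚ) / den e

/-- The weights are admissible. -/
lemma isProbVec_p : IsProbVec p := by
  refine ⟨fun e => ?_, fun e => ?_⟩ <;> fin_cases e <;> simp [p, num, den] <;> norm_num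

/-- The integer weight of a configuration: `Π_e (num_e if open else den_e − num_e)`. -/
def W (ω : Config (Fin 10)) : ℤ := ∏ e, (if ω e then (num e : ℤ) else (den e : ℤ) - num e)

/-- The common denominator `B = Π_e den_e`. -/
def B : ℤ := ∏ e, (den e : ℤ)

/-- `B = 105185679091920`. -/
lemma B_eq : B = 105185679091920 := by
  unfold B den
  simp only [Fin.prod_univ_succ, Fin.prod_univ_zero, Matrix.cons_val_zero, Matrix.cons_val_succ,
    Fin.isValue]
  norm_num

/-- The edge factor at an edge is the integer factor over the denominator. -/
lemma edgeFactor_eq (ω : Config (Fin 10)) (e : Fin 10) :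
    edgeFactor (p e) (ω e) = ((if ω e then (num e : ℤ) else (den e : ℤ) - num e : ℤ) : ℚ) / den e := by
  unfold edgeFactor p
  cases ω e
  · simp only [Bool.false_eq_true, if_false]
    fin_cases e <;> simp [num, den] <;> norm_num
  · simp only [if_true, Int.cast_natCast]

/-- The weight of a configuration is `W ω / B`. -/
lemma weight_eq (ω : Config (Fin 10)) : weight p ω = ((W ω : ℤ) : ℚ) / ((B : ℤ) : ℚ) := by
  unfold weight W B
  rw [Int.cast_prod, Int.cast_prod, ← prod_div_distrib]
  exact prod_congr rfl fun e _ => by rw [edgeFactor_eq]; push_cast; rfl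

/-- The integer sum of the weights over the configurations satisfying a Boolean predicate. -/
def S (b : Config (Fin 10) → Bool) : ℤ := ∑ ω : Config (Fin 10), if b ω then W ω else 0

/-- The probability of an event decided by `b` is `S b / B`. -/
lemma prob_eq {A : Set (Config (Fin 10))} {b : Config (Fin 10) → Bool}
    (h : ∀ ω, ω ∈ A ↔ b ω = true) : prob p A = ((S b : ℤ) : ℚ) / ((B : ℤ) : ℚ) := by
  unfold prob S
  rw [Int.cast_sum, sum_div]
  refine sum_congr rfl fun ω _ => ?_
  by_cases hb : b ω = true
  · rw [Set.indicator_of_mem ((h ω).2 hb), if_pos hb, weight_eq]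
  · rw [Set.indicator_of_notMem (fun hc => hb ((h ω).1 hc)), if_neg hb]; simp

/-- Membership in an intersection is decided by the conjunction. -/
lemma mem_inter_iff_and {A A' : Set (Config (Fin 10))} {a a' : Config (Fin 10) → Bool}
    (hA : ∀ ω, ω ∈ A ↔ a ω = true) (hA' : ∀ ω, ω ∈ A' ↔ a' ω = true) (ω : Config (Fin 10)) :
    ω ∈ A ∩ A' ↔ (a ω && a' ω) = true := by
  rw [Set.mem_inter_iff, hA, hA', Bool.and_eq_true]

/-- `S_Q = 5892411311280`. -/
lemma S_Q : S (fun ω => inC ω 1) = 5892411311280 := by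
  unfold S
  simp only [KTwoFive.sum_pi_succ]
  decide

/-- `S_U = 98805480778800`. -/
lemma S_U : S (fun ω => inC ω 5) = 98805480778800 := by
  unfold S
  simp only [KTwoFive.sum_pi_succ]
  decide

/-- `S_e = 95444167476270`. -/
lemma S_e : S (fun ω => inC ω 6) = 95444167476270 := by
  unfold S
  simp only [KTwoFive.sum_pi_succ]
  decide

/-- `S_QU = 5536053630000`. -/
lemma S_QU : S (fun ω => inC ω 1 && inC ω 5) = 5536053630000 := by
  unfold S
  simp only [KTwoFive.sum_pi_succ]
  decide

/-- `S_Qe = 5346893897580`. -/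
lemma S_Qe : S (fun ω => inC ω 1 && inC ω 6) = 5346893897580 := by
  unfold S
  simp only [KTwoFive.sum_pi_succ]
  decide

/-- `S_Ue = 89654855457900`. -/
lemma S_Ue : S (fun ω => inC ω 5 && inC ω 6) = 89654855457900 := by
  unfold S
  simp only [KTwoFive.sum_pi_succ]
  decide

/-- `S_QUe = 5023527653100`. -/
lemma S_QUe : S (fun ω => inC ω 1 && inC ω 5 && inC ω 6) = 5023527653100 := by
  unfold S
  simp only [KTwoFive.sum_pi_succ]
  decide

/-- **The three-event form is `−152322110525 / 512223476205017418324504`.** -/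
theorem t_form_eq :
    let Q := clusterInEvent ends 0 {T : Set (Fin 7) | (1 : Fin 7) ∈ T}
    let U := clusterInEvent ends 0 {T : Set (Fin 7) | (5 : Fin 7) ∈ T}
    let e := clusterInEvent ends 0 {T : Set (Fin 7) | (6 : Fin 7) ∈ T}
    prob p (Q ∩ U ∩ e) + prob p Q * prob p (U ∩ e) - prob p (Q ∩ U) * prob p e
      - prob p (Q ∩ e) * prob p U = -152322110525 / 512223476205017418324504 := by
  intro Q U e
  rw [prob_eq (mem_inter_iff_and (mem_inter_iff_and mem_Q_iff mem_U_iff) mem_e_iff),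
    prob_eq mem_Q_iff, prob_eq (mem_inter_iff_and mem_U_iff mem_e_iff),
    prob_eq (mem_inter_iff_and mem_Q_iff mem_U_iff), prob_eq mem_e_iff,
    prob_eq (mem_inter_iff_and mem_Q_iff mem_e_iff), prob_eq mem_U_iff,
    S_QUe, S_Q, S_Ue, S_QU, S_e, S_Qe, S_U, B_eq]
  norm_num

/-- **`(T_h)` is FALSE**: on `G` with the weights `p` and the single-vertex up-sets `{x₅ ∈ T}`,
`{x₆ ∈ T}`, `P(Q ∩ U ∩ e) + P(Q) P(U ∩ e) < P(Q ∩ U) P(e) + P(Q ∩ e) P(U)`. -/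
theorem t_form_neg :
    let Q := clusterInEvent ends 0 {T : Set (Fin 7) | (1 : Fin 7) ∈ T}
    let U := clusterInEvent ends 0 {T : Set (Fin 7) | (5 : Fin 7) ∈ T}
    let e := clusterInEvent ends 0 {T : Set (Fin 7) | (6 : Fin 7) ∈ T}
    prob p (Q ∩ U ∩ e) + prob p Q * prob p (U ∩ e) <
      prob p (Q ∩ U) * prob p e + prob p (Q ∩ e) * prob p U := by
  intro Q U e
  have h := t_form_eq
  simp only at h
  have : (-152322110525 : ℚ) / 512223476205017418324504 < 0 := by norm_num
  linarith

/-- **The general three-event statement is false**: there are a finite graph, a root, a hit vertex,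
admissible weights and up-sets `𝓤 𝓥` of vertex sets violating the inequality. -/
theorem not_t_general :
    ¬ ∀ (ends' : Fin 10 → Sym2 (Fin 7)) (p' : Fin 10 → ℚ), IsProbVec p' →
      ∀ (s h : Fin 7) (𝓤 𝓥 : Set (Set (Fin 7))), IsUpperSet 𝓤 → IsUpperSet 𝓥 →
        prob p' (clusterInEvent ends' s {T : Set (Fin 7) | h ∈ T} ∩ clusterInEvent ends' s 𝓤)
            * prob p' (clusterInEvent ends' s 𝓥)
          + prob p' (clusterInEvent ends' s {T : Set (Fin 7) | h ∈ T} ∩ clusterInEvent ends' s 𝓥)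
            * prob p' (clusterInEvent ends' s 𝓤) ≤
          prob p' (clusterInEvent ends' s {T : Set (Fin 7) | h ∈ T} ∩ clusterInEvent ends' s 𝓤
              ∩ clusterInEvent ends' s 𝓥)
            + prob p' (clusterInEvent ends' s {T : Set (Fin 7) | h ∈ T})
              * prob p' (clusterInEvent ends' s 𝓤 ∩ clusterInEvent ends' s 𝓥) := by
  intro hall
  have h := hall ends p isProbVec_p 0 1 {T : Set (Fin 7) | (5 : Fin 7) ∈ T}
    {T : Set (Fin 7) | (6 : Fin 7) ∈ T} (fun _ _ h hT => h hT) (fun _ _ h hT => h hT)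
  have h' := t_form_neg
  simp only at h'
  linarith

end Form

end THRefutation

end Summit.Ventures.PercRepro2
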